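import Literature.AlgebraicGeometry.Resolution.DiffOpOfFrobeniusLinear
import Mathlib.Algebra.BigOperators.Ring.Finset
import HarnessLib

/-!
# Monomial `p`-basis calculus for `x`-Cartier extensions, I: generator criterion, coordinates, the `xᵢ`-shift

Topic `Literature/AlgebraicGeometry/Resolution`, companion of `DifferentialOperators.lean` (EGA IV₄ §16.8, the predicate
`IsDiffOpLE R n D` by the commutator recursion 16.8.8 (b)), `DiffOpFrobeniusLinear.lean` / `DiffOpOfFrobeniusLinear.lean`
(`ad_f^{p^N} = [·, f^{p^N}]`, the generator criteria). SETTING (abstract «`p`-basis»): a commutative `R`-algebra `A`,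
elements `x₁, …, xₙ ∈ A`, an exponent `q ≥ 1`, a subalgebra `S ⊆ A` containing the `xᵢ^q`, and COORDINATES
`π_α : A →ₗ[R] S`, `α : Fin n → Fin q`, with

  (P1) `f = Σ_α x^α · π_α(f)` for every `f`, and (P2) `π_α(Σ_β x^β h_β) = h_α` for every family `h : (Fin n → Fin q) → S`

(i.e. `A` is free over `S` on the monomials `x^α`, `0 ≤ α_i < q` — for a regular local ring of characteristic `p` with
perfect residue field, `S = ρ^e(A)` and `q = p^e` this is Kunz's theorem / Hironaka's Lem. 3.6 p.9 «`{x^α}` are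
`ρ^e(O_ξ)`-linearly independent»), together with the Frobenius nilpotency `ad_{xᵢ}^q T = 0` for `S`-linear `T`
(`DiffOpOfFrobeniusLinear.adMul_pow_char_pow_apply` when `q = p^N`, `(p : A) = 0`).

This first file provides: EGA's recursion 16.8.8 (b) in generator form (`isDiffOpLE_succ_of_adjoin`), the linear
coordinate maps from spanning + uniqueness (`exists_coord`), their `S`-linearity, `A = R[S, x]`
(`adjoin_eq_top_of_coord`), and the SHIFT IDENTITY `xᵢ · Σ_α x^α h_α = Σ_β x^β h′_β` with the carry
`h′_β = xᵢ^q · h_{β[i↦q−1]}` at `β_i = 0` (`x_mul_sum_monomial`). The order bound for Cartier-shaped operators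
(«`∆(ℓ) ∈ Diff^{(mp^ℓ)}`», ms. p.38 l.6–7) is the second file `DiffOpCartierOrder.lean`. No definitions: operators are
handled through their characterising identities.

Bearing (index only): H. Hironaka, *Resolution of singularities in positive characteristics* (ms. 2017), Lem. 3.6 /
Def. 3.7 / Eq. (10) p.9–10, proof of Lem. 7.10 p.38 l.6–8 (HIRONAKA-L Q-07-028 `U38L6`; Q-03-005 `Lem3_6`).

## References
* A. Grothendieck, J. Dieudonné, ÉGA IV₄, Publ. Math. IHÉS 32 (1967), §16.8, Prop. 16.8.8 (b), Prop. 16.8.9. [EGAIV4]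
* E. Kunz, Amer. J. Math. 91 (1969), Thm. 2.1 (the monomial `p`-basis of a regular local ring). [Kunz1969]
* H. Hironaka, ms. 2017-03-23, Lem. 3.6 p.9, p.38 l.6–7. [Hironaka2017] (unrefereed manuscript under adjudication — kernel
  support, nothing of the manuscript asserted)
-/

namespace Literature.AlgebraicGeometry.Resolution

open Finset

universe u v

section GeneratorCriterion

variable (R : Type u) {A : Type v} [CommSemiring R] [CommRing A] [Algebra R A]

/-- **EGA's recursion 16.8.8 (b) on generators**: if `A = R[G]` and every commutator `[D, g]`, `g ∈ G`, has order `≤ N`,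
then `D` has order `≤ N + 1` (the set of `a` with `[D, a] ∈ Diff^{≤ N}` is a subalgebra, by the Leibniz rule
`[D, ab] = [D, a] ∘ b̂ + â ∘ [D, b]` and 16.8.9). [cite: EGAIV4, Prop. 16.8.8 (b), Prop. 16.8.9] -/
theorem isDiffOpLE_succ_of_adjoin {G : Set A} (hG : Algebra.adjoin R G = ⊤) {N : ℕ} {D : A →ₗ[R] A}
    (h : ∀ g ∈ G, IsDiffOpLE R N (commMul R D g)) : IsDiffOpLE R (N + 1) D := by
  intro a
  have ha : a ∈ Algebra.adjoin R G := by rw [hG]; exact Algebra.mem_top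
  refine Algebra.adjoin_induction (p := fun b _ => IsDiffOpLE R N (commMul R D b)) ?_ ?_ ?_ ?_ ha
  · exact h
  · intro r; rw [commMul_algebraMap]; exact IsDiffOpLE.zero N
  · intro b b' _ _ hb hb'; rw [commMul_add_right]; exact hb.add hb'
  · intro b b' _ _ hb hb'
    rw [commMul_mul_right]
    have h1 : IsDiffOpLE R N (commMul R D b ∘ₗ LinearMap.mulLeft R b') := by
      simpa using hb.comp (isDiffOpLE_mulLeft (R := R) b')
    have h2 : IsDiffOpLE R N (LinearMap.mulLeft R b ∘ₗ commMul R D b') := by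
      simpa using (isDiffOpLE_mulLeft (R := R) b).comp hb'
    exact h1.add h2

/-- The commutator of an `S`-commuting operator with `a` still commutes with `S` (`ad_a` and `ad_s` commute).
[cite: EGAIV4, Prop. 16.8.8 (16.8.8.1)] -/
theorem commMul_commMul_eq_zero_of_commMul_eq_zero {D : A →ₗ[R] A} {s : A} (hs : commMul R D s = 0) (a : A) :
    commMul R (commMul R D a) s = 0 := by
  have h := commMul_adMul_pow_apply_eq_zero R hs a 1
  rwa [pow_one] at h

end GeneratorCriterion

section Cartier

variable (R : Type u) {A : Type v} [CommRing R] [CommRing A] [Algebra R A] {n q : ℕ}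

/-! ### The coordinates: consequences of (P1), (P2) -/

variable (x : Fin n → A) (e : (Fin n → Fin q) → A) (S : Subalgebra R A) (π : (Fin n → Fin q) → A →ₗ[R] S)

/-- (P1) makes `S ∪ {xᵢ}` generate `A` as an `R`-algebra. [cite: Kunz1969, Thm. 2.1] -/
theorem adjoin_eq_top_of_coord (he : ∀ α, e α = ∏ j, x j ^ ((α j : Fin q) : ℕ))
    (hπ₁ : ∀ f : A, f = ∑ α, e α * (π α f : A)) :
    Algebra.adjoin R ((S : Set A) ∪ Set.range x) = ⊤ := by
  refine Algebra.eq_top_iff.mpr fun f => ?_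
  rw [hπ₁ f]
  refine Subalgebra.sum_mem _ fun α _ => Subalgebra.mul_mem _ ?_ ?_
  · rw [he α]
    refine Subalgebra.prod_mem _ fun j _ => Subalgebra.pow_mem _ ?_ _
    exact Algebra.subset_adjoin (Or.inr ⟨j, rfl⟩ : x j ∈ (S : Set A) ∪ Set.range x)
  · exact Algebra.subset_adjoin (Or.inl (π α f).2 : (π α f : A) ∈ (S : Set A) ∪ Set.range x)

/-- The coordinates are `S`-linear: `π_α(s·f) = s·π_α(f)` (from (P1) and the uniqueness (P2)). [cite: Kunz1969, Thm. 2.1] -/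
theorem coord_mul_left (hπ₁ : ∀ f : A, f = ∑ α, e α * (π α f : A))
    (hπ₂ : ∀ (h : (Fin n → Fin q) → S) (α : Fin n → Fin q), π α (∑ β, e β * (h β : A)) = h α)
    (s : S) (f : A) (α : Fin n → Fin q) : π α ((s : A) * f) = s * π α f := by
  have hf : (s : A) * f = ∑ β, e β * ((s * π β f : S) : A) := by
    conv_lhs => rw [hπ₁ f]
    rw [Finset.mul_sum]
    exact Finset.sum_congr rfl fun β _ => by rw [Subalgebra.coe_mul]; ring
  rw [hf, hπ₂]

/-- An `S`-commuting operator is `S`-linear on products (plumbing). [folklore] -/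
private theorem apply_mul_of_commMul_eq_zero {T : A →ₗ[R] A} (hTS : ∀ s : S, commMul R T s = 0) (s : S) (f : A) :
    T ((s : A) * f) = (s : A) * T f := by
  have h := LinearMap.congr_fun (hTS s) f
  rw [commMul_apply, LinearMap.zero_apply, sub_eq_zero] at h
  exact h

/-! ### The shift identity `xᵢ · Σ_α x^α h_α = Σ_β x^β (shiftᵢ h)_β` -/

/-- **Multiplication by `xᵢ` in coordinates** («carry» at `α_i = q − 1` through `xᵢ^q ∈ S`): for a family
`h : (Fin n → Fin q) → S`, `xᵢ · Σ_α x^α h_α = Σ_β x^β h′_β` with `h′_β = xᵢ^q · h_{β[i ↦ q−1]}` if `β_i = 0` and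
`h′_β = h_{β[i ↦ β_i − 1]}` otherwise. [cite: Kunz1969, Thm. 2.1] -/
theorem x_mul_sum_monomial (hq : 0 < q) (he : ∀ α, e α = ∏ j, x j ^ ((α j : Fin q) : ℕ)) (i : Fin n)
    (hxS : x i ^ q ∈ S) (h : (Fin n → Fin q) → S) :
    x i * ∑ α, e α * (h α : A) =
      ∑ β, e β * ((if ((β i : Fin q) : ℕ) = 0 then
          (⟨x i ^ q, hxS⟩ : S) * h (Function.update β i ⟨q - 1, Nat.sub_lt hq Nat.one_pos⟩)
        else h (Function.update β i ⟨((β i : Fin q) : ℕ) - 1,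
          lt_of_le_of_lt (Nat.sub_le _ _) (β i).2⟩) : S) : A) := by
  classical
  -- the cyclic successor in the `i`-th coordinate
  let sv : Fin q → Fin q := fun a => if ha : (a : ℕ) + 1 < q then ⟨(a : ℕ) + 1, ha⟩ else ⟨0, hq⟩
  let succ : (Fin n → Fin q) → (Fin n → Fin q) := fun α => Function.update α i (sv (α i))
  have sv_inj : Function.Injective sv := by
    intro a b hab
    simp only [sv] at hab
    apply Fin.ext
    by_cases ha : (a : ℕ) + 1 < q <;> by_cases hb : (b : ℕ) + 1 < q
    · rw [dif_pos ha, dif_pos hb] at hab; have := Fin.mk.inj_iff.mp hab; omega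
    · rw [dif_pos ha, dif_neg hb] at hab; have := Fin.mk.inj_iff.mp hab; omega
    · rw [dif_neg ha, dif_pos hb] at hab; have := Fin.mk.inj_iff.mp hab; omega
    · have h1 := a.2; have h2 := b.2; omega
  have succ_inj : Function.Injective succ := by
    intro α α' hαα'
    have hi : sv (α i) = sv (α' i) := by
      have := congrFun hαα' i
      simpa only [succ, Function.update_self] using this
    have hii : α i = α' i := sv_inj hi
    funext j
    rcases eq_or_ne j i with rfl | hj
    · exact hii
    · have := congrFun hαα' j
      simpa only [succ, Function.update_of_ne hj] using this
  have succ_bij : Function.Bijective succ := (Finite.injective_iff_bijective).mp succ_inj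
  rw [Finset.mul_sum]
  refine Fintype.sum_bijective succ succ_bij _ _ fun α => ?_
  -- termwise: `xᵢ · x^α · h_α = x^{succ α} · h′_{succ α}`
  have hsi : succ α i = sv (α i) := by simp only [succ, Function.update_self]
  by_cases hα : ((α i : Fin q) : ℕ) + 1 < q
  · -- no carry
    have hsv : sv (α i) = ⟨((α i : Fin q) : ℕ) + 1, hα⟩ := by simp only [sv, dif_pos hα]
    have hne : ((succ α i : Fin q) : ℕ) ≠ 0 := by rw [hsi, hsv]; exact Nat.succ_ne_zero _
    rw [if_neg hne]
    have hback : Function.update (succ α) i ⟨((succ α i : Fin q) : ℕ) - 1,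
        lt_of_le_of_lt (Nat.sub_le _ _) (succ α i).2⟩ = α := by
      have hv : (⟨((succ α i : Fin q) : ℕ) - 1, lt_of_le_of_lt (Nat.sub_le _ _) (succ α i).2⟩ : Fin q) = α i :=
        Fin.ext (by rw [Fin.val_mk, hsi, hsv, Fin.val_mk, Nat.add_sub_cancel])
      rw [hv]
      simp only [succ, Function.update_idem, Function.update_eq_self]
    rw [hback, he, he]
    have hsplit := Finset.mul_prod_erase Finset.univ
      (fun j => x j ^ ((Function.update α i (sv (α i)) j : Fin q) : ℕ)) (Finset.mem_univ i)
    have hsplit' := Finset.mul_prod_erase Finset.univ (fun j => x j ^ ((α j : Fin q) : ℕ)) (Finset.mem_univ i)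
    have hrest : ∏ j ∈ Finset.univ.erase i, x j ^ ((Function.update α i (sv (α i)) j : Fin q) : ℕ) =
        ∏ j ∈ Finset.univ.erase i, x j ^ ((α j : Fin q) : ℕ) :=
      Finset.prod_congr rfl fun j hj => by rw [Function.update_of_ne (Finset.ne_of_mem_erase hj)]
    simp only [Function.update_self] at hsplit
    change x i * ((∏ j, x j ^ ((α j : Fin q) : ℕ)) * (h α : A)) =
      (∏ j, x j ^ ((Function.update α i (sv (α i)) j : Fin q) : ℕ)) * (h α : A)
    have hsvv : ((sv (α i) : Fin q) : ℕ) = ((α i : Fin q) : ℕ) + 1 := by rw [hsv]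
    rw [← hsplit, ← hsplit', hrest, hsvv, pow_succ]
    ring
  · -- carry: `α_i = q − 1`
    have hαi : ((α i : Fin q) : ℕ) = q - 1 := by have := (α i).2; omega
    have hsv : sv (α i) = ⟨0, hq⟩ := by simp only [sv, dif_neg hα]
    have h0 : ((succ α i : Fin q) : ℕ) = 0 := by rw [hsi, hsv]
    rw [if_pos h0]
    have hup : Function.update (succ α) i ⟨q - 1, Nat.sub_lt hq Nat.one_pos⟩ = α := by
      have hv : (⟨q - 1, Nat.sub_lt hq Nat.one_pos⟩ : Fin q) = α i := Fin.ext (by rw [Fin.val_mk, hαi])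
      rw [hv]
      simp only [succ, Function.update_idem, Function.update_eq_self]
    rw [hup, Subalgebra.coe_mul, he, he]
    have hsplit := Finset.mul_prod_erase Finset.univ
      (fun j => x j ^ ((Function.update α i (sv (α i)) j : Fin q) : ℕ)) (Finset.mem_univ i)
    have hsplit' := Finset.mul_prod_erase Finset.univ (fun j => x j ^ ((α j : Fin q) : ℕ)) (Finset.mem_univ i)
    have hrest : ∏ j ∈ Finset.univ.erase i, x j ^ ((Function.update α i (sv (α i)) j : Fin q) : ℕ) =
        ∏ j ∈ Finset.univ.erase i, x j ^ ((α j : Fin q) : ℕ) :=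
      Finset.prod_congr rfl fun j hj => by rw [Function.update_of_ne (Finset.ne_of_mem_erase hj)]
    simp only [Function.update_self] at hsplit
    change x i * ((∏ j, x j ^ ((α j : Fin q) : ℕ)) * (h α : A)) =
      (∏ j, x j ^ ((Function.update α i (sv (α i)) j : Fin q) : ℕ)) * (x i ^ q * (h α : A))
    have hsvv : ((sv (α i) : Fin q) : ℕ) = 0 := by rw [hsv]
    rw [← hsplit, ← hsplit', hrest, hsvv, pow_zero, hαi]
    have hxq : x i ^ q = x i ^ (q - 1) * x i := by rw [← pow_succ, Nat.sub_add_cancel hq]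
    rw [hxq]
    ring

/-! ### Coordinates from spanning and independence -/

/-- **Coordinates.** If every `f` is `Σ_α x^α h_α` for some family `h` with values in `S` and such a family is
unique, the coefficient maps `π_α : A → S` are `R`-linear and satisfy (P1) `f = Σ_α x^α π_α(f)` and
(P2) `π_α(Σ_β x^β h_β) = h_α`. [cite: Kunz1969, Thm. 2.1] -/
theorem exists_coord
    (hex : ∀ f : A, ∃ h : (Fin n → Fin q) → S, f = ∑ α, e α * (h α : A))
    (huniq : ∀ h h' : (Fin n → Fin q) → S, ∑ α, e α * (h α : A) = ∑ α, e α * (h' α : A) → h = h') :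
    ∃ π : (Fin n → Fin q) → A →ₗ[R] S,
      (∀ f : A, f = ∑ α, e α * (π α f : A)) ∧
      (∀ (h : (Fin n → Fin q) → S) (α : Fin n → Fin q), π α (∑ β, e β * (h β : A)) = h α) := by
  choose H hH using hex
  have hadd : ∀ f g : A, H (f + g) = H f + H g := by
    intro f g
    refine huniq _ _ ?_
    rw [← hH (f + g)]
    simp only [Pi.add_apply, Subalgebra.coe_add, mul_add, Finset.sum_add_distrib, ← hH f, ← hH g]
  have hsmul : ∀ (c : R) (f : A), H (c • f) = c • H f := by
    intro c f
    refine huniq _ _ ?_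
    rw [← hH (c • f)]
    simp only [Pi.smul_apply, Subalgebra.coe_smul, mul_smul_comm, ← Finset.smul_sum, ← hH f]
  refine ⟨fun α => { toFun := fun f => H f α
                     map_add' := fun f g => by rw [hadd]; rfl
                     map_smul' := fun c f => by rw [hsmul]; rfl }, fun f => hH f, fun h α => ?_⟩
  have hh : H (∑ β, e β * (h β : A)) = h := huniq _ _ (hH _).symm
  exact congrFun hh α

end Cartier

end Literature.AlgebraicGeometry.Resolution
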